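import Literature.NumberTheory.LFunctions.HardyZRiemannSiegelEvaluation
import Literature.NumberTheory.LFunctions.RiemannSiegelIntegralFormula
import Literature.NumberTheory.LFunctions.RiemannZetaChiTheta
import Literature.NumberTheory.LFunctions.RiemannSiegelPhase
import Literature.NumberTheory.LFunctions.SiegelMordellIntegralTwo
import Literature.NumberTheory.LFunctions.RiemannSiegelGabckeG
import HarnessLib

/-!
# `Z(t)` after the saddle-point substitution (Gabcke 1979, Satz 1.2.1) in the tree's conventions

Topic `Literature/NumberTheory/LFunctions`. Third file of an explicit bound for the remainder
`R₀(t) = Z(t) − 2Σ_{n≤N} cos(ϑ − t log n)/√n − (−1)^{N−1} a^{−1/2} F(z)` of the Riemann–Siegel formula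
(`Literature.NumberTheory.LFunctions.Gabcke.R0`, `HardyZRiemannSiegelEvaluation.lean`). From the tree's
Riemann–Siegel integral formula (`SiegelIntegral.riemannZeta_eq_riemannAux_add`) and residue shift
(`SiegelIntegral.riemannAux_eq_sum_add_rsLineIntegral`) we derive Gabcke's Satz 1.2.1 — `Z(t)` = main sum +
`(−1)^{N−1}(t/2π)^{−1/4} Re(U·S)` — in the form

  `Z(t) = 2Σ_{n≤N} cos(ϑ − t log n)/√n + (2/√a) Re(U* · T(a))`,  `a = √(t/2π) ∉ ℤ`,

where `U* = e^{i(ϑ(t) − ϑ_m(t))}` (`ϑ_m` the Stirling main term; Gabcke's `U` conjugated),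
`T(a) = −√2 e^{iπ/8} ∫ e^{−4πu²} g̃(a,u) du / (2i sin π(a + u(1+i)))` is the integral over Siegel's line of
steepest descent through the saddle point `x = a` with Gabcke's `g̃` (`RiemannSiegelGabckeG.lean`), and
`T₀(a)` is the same integral with `g̃ ≡ 1`, which `SiegelMordellIntegralTwo.lean` puts in closed form:

* `rsKernel_saddle` — `F_s(a + u(1+i)) = a^{−s} e^{πia²} · e^{−4πu²} g̃(a,u)/(2i sin πx)` (eq. (1.8));
* `hardyZ_eq_mainSum_add` — Satz 1.2.1 as displayed above;
* `two_mul_re_rsT0` — `2 Re T₀(a) = (−1)^{N+1} F(z)`, `z = 1 − 2(a − N)` (Gabcke (1.14)–(1.16): the leading term IS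
  `C₀ = F`), and `norm_rsT0_le` — `|T₀(a)| ≤ (√2/4) e^{π/4}` uniformly (line moved to `N + ½`);
* `R0_eq` and **`abs_R0_le`** — `|R₀(t)| ≤ (2/√a) (√2 ∫ e^{−4πu²}|g̃ − 1|/|2 sin πx| du + (2K(¼)/t)(√2/4)e^{π/4})`,
  the input of the integration file `RiemannSiegelRemainderK0.lean` (the `U* − 1` term by the tree's Stirling
  bound `abs_riemannSiegelTheta_sub_stirling_le`).

No facts, no axioms beyond the standard three.

## References

* W. Gabcke, *Neue Herleitung und explizite Restabschätzung der Riemann-Siegel-Formel*, Dissertation,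
  Göttingen 1979: Kap. 1 eqs. (1.4)–(1.9), Satz 1.2.1 p. 12, (1.13)–(1.16) p. 13. [Gabcke1979]
* C. L. Siegel, *Über Riemanns Nachlaß zur analytischen Zahlentheorie* (1932), §3. [Siegel1932]
-/

noncomputable section

open Complex Real Set MeasureTheory Filter
open Literature.NumberTheory.LFunctions.SiegelIntegral

namespace Literature.NumberTheory.LFunctions

namespace Gabcke

/-! ## Objects -/

/-- The Stirling main term `ϑ_m(t) = (t/2) log(t/2π) − t/2 − π/8` of `ϑ`. [cite: Gabcke1979, Einleitung (4) p. 2] -/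
def thetaMain (t : ℝ) : ℝ := t / 2 * Real.log (t / (2 * π)) - t / 2 - π / 8

/-- `U* = e^{i(ϑ − ϑ_m)}` (the complex conjugate of Gabcke's `U`, (1.9); `U* → 1`). [cite: Gabcke1979, Kap. 1 eq. (1.9)] -/
def uStar (t : ℝ) : ℂ := cexp (((riemannSiegelTheta t - thetaMain t : ℝ) : ℂ) * I)

/-- The integrand `k(a,u) = e^{−4πu²} g̃(a,u) / (2i sin π(a + u(1+i)))` on the saddle-point line.
[cite: Gabcke1979, Kap. 1 eq. (1.9)] -/
def rsKer (a u : ℝ) : ℂ := (Real.exp (-4 * π * u ^ 2) : ℂ) * gTilde a u / (2 * I * Complex.sin (π * line a u))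

/-- The same integrand with `g̃ ≡ 1`: `k₀(a,u) = e^{−4πu²} / (2i sin π(a + u(1+i)))`. [cite: Gabcke1979, Kap. 1 eq. (1.13)] -/
def rsKer0 (a u : ℝ) : ℂ := (Real.exp (-4 * π * u ^ 2) : ℂ) / (2 * I * Complex.sin (π * line a u))

/-- `T(a) = −√2 e^{iπ/8} ∫ k(a,u) du` (Gabcke's `S`, conjugated and renormalised: `Re(U S) = 2 Re(U* T)`).
[cite: Gabcke1979, Kap. 1 eq. (1.9)] -/
def rsT (a : ℝ) : ℂ := -(Real.sqrt 2 : ℂ) * cexp (π * I / 8) * ∫ u : ℝ, rsKer a u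

/-- `T₀(a) = −√2 e^{iπ/8} ∫ k₀(a,u) du`, the leading term (Gabcke's `F̃(q)`, (1.13), renormalised).
[cite: Gabcke1979, Kap. 1 eq. (1.13)] -/
def rsT0 (a : ℝ) : ℂ := -(Real.sqrt 2 : ℂ) * cexp (π * I / 8) * ∫ u : ℝ, rsKer0 a u

variable {a u t : ℝ}

/-! ## The saddle-point factorisation of Siegel's integrand (eq. (1.8)) -/

/-- `a + u(1+i) = a(1 + w)`. [folklore] -/
private lemma line_eq_mul (ha : a ≠ 0) (u : ℝ) : line a u = (a : ℂ) * (1 + gW a u) := by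
  have ha' : (a : ℂ) ≠ 0 := Complex.ofReal_ne_zero.2 ha
  simp only [line, gW]; field_simp

/-- `w² = 2iu²/a²`. [folklore] -/
private lemma gW_sq' (ha : a ≠ 0) : gW a u ^ 2 = 2 * I * (u : ℂ) ^ 2 / (a : ℂ) ^ 2 := by
  have ha' : (a : ℂ) ≠ 0 := Complex.ofReal_ne_zero.2 ha
  simp only [gW]; field_simp; ring_nf; rw [Complex.I_sq]; ring

/-- **Eq. (1.8) on the line of steepest descent**: for `a > 0`, `t = 2πa²`, `s = ½ + it` and `x = a + u(1+i)`,
`x^{−s} e^{πix²} = a^{−s} e^{πia²} · e^{−4πu²} · g̃(a, u)`. [cite: Gabcke1979, Kap. 1 eq. (1.8)] -/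
theorem cpow_mul_cexp_saddle (ha : 0 < a) (ht : t = 2 * π * a ^ 2) (u : ℝ) :
    (line a u) ^ (-(1 / 2 + t * I : ℂ)) * cexp (π * I * (line a u) ^ 2) =
      (a : ℂ) ^ (-(1 / 2 + t * I : ℂ)) * cexp (π * I * (a : ℂ) ^ 2)
        * ((Real.exp (-4 * π * u ^ 2) : ℂ) * gTilde a u) := by
  have ha0 : a ≠ 0 := ha.ne'
  have ha' : (a : ℂ) ≠ 0 := Complex.ofReal_ne_zero.2 ha0
  have hw0 : 1 + gW a u ≠ 0 := one_add_gW_ne_zero ha0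
  have hx0 : line a u ≠ 0 := by rw [line_eq_mul ha0]; exact mul_ne_zero ha' hw0
  rw [Complex.cpow_def_of_ne_zero hx0, Complex.cpow_def_of_ne_zero ha', line_eq_mul ha0,
    Complex.log_ofReal_mul ha hw0, ← Complex.ofReal_log ha.le, Complex.ofReal_exp, gTilde]
  simp only [← Complex.exp_add]
  congr 1
  rw [ht, gExp]
  set L := Complex.log (1 + gW a u)
  have hsq := gW_sq' (u := u) ha0
  -- reduce to a polynomial identity: the `L` terms cancel because `−s + 1/2 + 2πia² = 0`
  have key : ((Real.log a : ℂ) + L) * -(1 / 2 + ((2 * π * a ^ 2 : ℝ) : ℂ) * I)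
      + π * I * ((a : ℂ) * (1 + gW a u)) ^ 2
      - ((Real.log a : ℂ) * -(1 / 2 + ((2 * π * a ^ 2 : ℝ) : ℂ) * I) + π * I * (a : ℂ) ^ 2
        + (((-4 * π * u ^ 2 : ℝ) : ℂ) + (2 * π * I * (a : ℂ) ^ 2 * (gW a u - gW a u ^ 2 / 2 - L) - L / 2)))
      = 2 * π * I * (a : ℂ) ^ 2 * gW a u ^ 2 + 4 * π * u ^ 2 := by
    push_cast; ring
  rw [← sub_eq_zero, key, hsq]
  field_simp
  ring_nf
  rw [Complex.I_sq]
  ring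

/-- Siegel's integrand on the line through the saddle point: `F_s(a + u(1+i)) = a^{−s} e^{πia²} k(a,u)`.
[cite: Gabcke1979, Kap. 1 eq. (1.9)] -/
theorem rsKernel_saddle (ha : 0 < a) (ht : t = 2 * π * a ^ 2) (u : ℝ) :
    rsKernel (1 / 2 + t * I) (line a u) =
      (a : ℂ) ^ (-(1 / 2 + t * I : ℂ)) * cexp (π * I * (a : ℂ) ^ 2) * rsKer a u := by
  rw [rsKernel, rsKer, mul_div_assoc', cpow_mul_cexp_saddle ha ht u]

/-! ## Satz 1.2.1: `Z(t) = main sum + (2/√a) Re(U* T)` -/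

/-- `(1+i) e^{−iπ/8} = √2 e^{iπ/8}`. [folklore] -/
private lemma one_add_I_mul_cexp : (1 + I) * cexp (-(π * I / 8)) = (Real.sqrt 2 : ℂ) * cexp (π * I / 8) := by
  have h4 : cexp (π * I / 4) = ((Real.sqrt 2 / 2 : ℝ) : ℂ) * (1 + I) := by
    rw [show (↑π * I / 4 : ℂ) = ((π / 4 : ℝ) : ℂ) * I by push_cast; ring, Complex.exp_mul_I,
      ← Complex.ofReal_cos, ← Complex.ofReal_sin, Real.cos_pi_div_four, Real.sin_pi_div_four]
    push_cast; ring
  have h8 : cexp (π * I / 4) = cexp (π * I / 8) * cexp (π * I / 8) := by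
    rw [← Complex.exp_add]; ring_nf
  have hinv : cexp (-(π * I / 8)) * cexp (π * I / 8) = 1 := by
    rw [← Complex.exp_add, neg_add_cancel, Complex.exp_zero]
  have hs : ((Real.sqrt 2 / 2 : ℝ) : ℂ) * (Real.sqrt 2 : ℂ) = 1 := by
    rw [← Complex.ofReal_mul, show Real.sqrt 2 / 2 * Real.sqrt 2 = (Real.sqrt 2 * Real.sqrt 2) / 2 by ring,
      Real.mul_self_sqrt (by norm_num : (0:ℝ) ≤ 2)]
    norm_num
  -- `(1+i) = √2 e^{iπ/4}` ⇒ `(1+i) e^{−iπ/8} = √2 e^{iπ/8}`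
  have h1 : (1 : ℂ) + I = (Real.sqrt 2 : ℂ) * cexp (π * I / 4) := by
    rw [h4]; linear_combination (-(1 + I)) * hs
  rw [h1, h8]
  linear_combination ((Real.sqrt 2 : ℂ) * cexp (π * I / 8)) * hinv

/-- The phase bookkeeping: `e^{iϑ} a^{−s} e^{πia²} = a^{−1/2} U* e^{−iπ/8}` for `t = 2πa²`, `s = ½ + it`
(`t log a = (t/2) log(t/2π)`, `πa² = t/2`). [cite: Gabcke1979, Kap. 1 eq. (1.9)] -/
theorem cexp_theta_mul_cpow (ha : 0 < a) (ht : t = 2 * π * a ^ 2) :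
    cexp ((riemannSiegelTheta t : ℂ) * I) * ((a : ℂ) ^ (-(1 / 2 + t * I : ℂ)) * cexp (π * I * (a : ℂ) ^ 2)) =
      (((Real.sqrt a)⁻¹ : ℝ) : ℂ) * uStar t * cexp (-(π * I / 8)) := by
  have ha' : (a : ℂ) ≠ 0 := Complex.ofReal_ne_zero.2 ha.ne'
  have hlog : Real.log (t / (2 * π)) = 2 * Real.log a := by
    rw [ht, show 2 * π * a ^ 2 / (2 * π) = a ^ 2 by field_simp, Real.log_pow]; push_cast; ring
  have hsqrt : ((Real.sqrt a)⁻¹ : ℝ) = Real.exp (-(Real.log a / 2)) := by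
    rw [Real.sqrt_eq_rpow, Real.rpow_def_of_pos ha, ← Real.exp_neg]; congr 1; ring
  rw [Complex.cpow_def_of_ne_zero ha', ← Complex.ofReal_log ha.le, hsqrt, Complex.ofReal_exp, uStar, thetaMain,
    hlog]
  simp only [← Complex.exp_add]
  congr 1
  push_cast
  rw [ht]; push_cast; ring

/-- **Gabcke 1979, Satz 1.2.1** in the tree's conventions: for `t > 0` with `a = √(t/2π)` not an integer and
`N = ⌊a⌋ ≥ 1`,
`Z(t) = 2 Σ_{n≤N} cos(ϑ(t) − t log n)/√n + (2/√a) Re(U*(t) · T(a))`. [cite: Gabcke1979, Satz 1.2.1] -/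
theorem hardyZ_eq_mainSum_add (ht : 0 < t) (hN : 1 ≤ Gabcke.N t) (hai : ∀ n : ℤ, (n : ℝ) ≠ Gabcke.a t) :
    hardyZ t = mainSum t + 2 / Real.sqrt (Gabcke.a t) * (uStar t * rsT (Gabcke.a t)).re := by
  set A : ℝ := Gabcke.a t with hA
  have hA0 : 0 < A := Real.sqrt_pos.2 (by positivity)
  have htA : t = 2 * π * A ^ 2 := by
    rw [hA, Gabcke.a, Real.sq_sqrt (by positivity)]; field_simp
  set s : ℂ := 1 / 2 + t * I with hs
  -- the integral formula on the critical line
  have hsre : s.re = 1 / 2 := by simp [hs]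
  have hζ := riemannZeta_eq_riemannAux_add (s := s) (by rw [hsre]; norm_num) (by rw [hsre]; norm_num)
    (fun h ↦ by have := congrArg Complex.re h; rw [hsre] at this; norm_num at this)
  have hsin : Complex.sin (π * s) ≠ 0 := by
    intro h0
    obtain ⟨n, hn⟩ := (Literature.Analysis.Complex.sin_pi_mul_eq_zero_iff s).1 h0
    have h1 := congrArg Complex.re hn
    rw [hsre] at h1
    simp only [Complex.intCast_re] at h1
    have h2 : (2 : ℝ) * n = 1 := by linarith
    have h3 : (2 : ℤ) * n = 1 := by exact_mod_cast h2
    omega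
  have hχ := rsChi_eq_riemannZetaChi hsin
  have hconj : riemannAuxConj s = (starRingEnd ℂ) (riemannAux s) := riemannAuxConj_half t
  have hθχ := cexp_theta_mul_riemannZetaChi_half t
  have hZ := ofReal_hardyZ_holds t
  -- `e^{iϑ} ζ = w + conj w`, `w = e^{iϑ} 𝓡(s)`
  set w : ℂ := cexp ((riemannSiegelTheta t : ℂ) * I) * riemannAux s with hw
  have hconjE : (starRingEnd ℂ) (cexp ((riemannSiegelTheta t : ℂ) * I)) = cexp (-((riemannSiegelTheta t : ℂ) * I)) := by
    rw [← Complex.exp_conj]; congr 1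
    simp only [map_mul, Complex.conj_ofReal, Complex.conj_I]; ring
  have hsum : (hardyZ t : ℂ) = w + (starRingEnd ℂ) w := by
    rw [hZ, hζ, hχ, hconj, mul_add, ← mul_assoc, hθχ, hw, map_mul, hconjE]
  have hre : hardyZ t = 2 * w.re := by
    have := congrArg Complex.re hsum
    rw [Complex.ofReal_re, Complex.add_re, Complex.conj_re] at this
    linarith
  -- split `𝓡(s)` into the main sum and the line integral through the saddle point
  have hNA : (Gabcke.N t : ℝ) < A :=
    lt_of_le_of_ne (Nat.floor_le hA0.le) (fun h ↦ hai (Gabcke.N t) (by exact_mod_cast h))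
  have hAN : A < Gabcke.N t + 1 := Nat.lt_floor_add_one A
  have hR := riemannAux_eq_sum_add_rsLineIntegral s hN hNA hAN
  have hmain := RSEval.mainSum_eq_re t
  -- the line integral in terms of `T`
  have hJ : cexp ((riemannSiegelTheta t : ℂ) * I) * rsLineIntegral A s
      = (((Real.sqrt A)⁻¹ : ℝ) : ℂ) * (uStar t * rsT A) := by
    have hker : ∀ u : ℝ, rsKernel s (line A u)
        = (A : ℂ) ^ (-(1 / 2 + t * I : ℂ)) * cexp (π * I * (A : ℂ) ^ 2) * rsKer A u := fun u ↦
      rsKernel_saddle hA0 htA u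
    simp only [rsLineIntegral, hker, MeasureTheory.integral_const_mul, rsT]
    have hph := cexp_theta_mul_cpow hA0 htA
    have h18 := one_add_I_mul_cexp
    linear_combination (-(∫ u : ℝ, rsKer A u)) * ((1 + I) * hph)
      + (-(((Real.sqrt A)⁻¹ : ℝ) : ℂ) * uStar t * ∫ u : ℝ, rsKer A u) * h18
  rw [hre, hw, hR, mul_add, Complex.add_re, hJ, Complex.re_ofReal_mul, hmain]
  simp only [RSEval.Wsum, hs]
  ring

/-! ## The leading term `T₀`: closed form of its real part, and a uniform bound -/

/-- `e^{2πi(u(1+i))²} = e^{−4πu²}`: the kernel `k₀` is the Mordell kernel of `SiegelMordellIntegralTwo.lean` on the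
line through `a`. [folklore] -/
private lemma cexp_sq_line_sub (a u : ℝ) :
    cexp (2 * π * I * (line a u - a) ^ 2) = (Real.exp (-4 * π * u ^ 2) : ℂ) := by
  rw [Complex.ofReal_exp]
  congr 1
  simp only [line]
  push_cast
  have hI3 : (I : ℂ) ^ 3 = -I := by rw [pow_succ, Complex.I_sq]; ring
  ring_nf
  simp only [Complex.I_sq, hI3]
  ring

/-- `T₀` is the object of `SiegelIntegral.two_mul_re_rsLeadTerm_mul_cos`. [folklore] -/
private lemma rsT0_eq (a : ℝ) :
    rsT0 a = -cexp (-(π * I / 8)) * ((1 + I) * ∫ u : ℝ, cexp (2 * π * I * (line a u - a) ^ 2)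
      / (2 * I * Complex.sin (π * line a u))) := by
  simp only [rsT0, rsKer0, cexp_sq_line_sub]
  linear_combination (∫ u : ℝ, (Real.exp (-4 * π * u ^ 2) : ℂ) / (2 * I * Complex.sin (π * line a u)))
    * one_add_I_mul_cexp

/-- **The leading term is Gabcke's `C₀ = F`** ((1.14)–(1.16)): for `a > 0` not an integer, `N = ⌊a⌋`,
`z = 1 − 2(a − N)` with `cos πz ≠ 0`, `2 Re T₀(a) = (−1)^{N+1} F(z)`. [cite: Gabcke1979, Kap. 1 eq. (1.16)] -/
theorem two_mul_re_rsT0 (ha : 0 < a) (hai : ∀ n : ℤ, (n : ℝ) ≠ a)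
    (hcos : Real.cos (π * (1 - 2 * (a - ⌊a⌋₊))) ≠ 0) :
    2 * (rsT0 a).re = (-1) ^ (⌊a⌋₊ + 1) * F (1 - 2 * (a - ⌊a⌋₊)) := by
  have h := two_mul_re_rsLeadTerm_mul_cos ha hai
  rw [← rsT0_eq] at h
  set N : ℕ := ⌊a⌋₊ with hN
  set z : ℝ := 1 - 2 * (a - N) with hz
  -- `cos 2πa = −cos πz` and `cos(2πa² − (4N+2)πa − π/8) = −cos π(z²/2 + 3/8)`
  have h1 : Real.cos (2 * π * a) = -Real.cos (π * z) := by
    rw [show 2 * π * a = (π - π * z) + (N : ℕ) * (2 * π) by rw [hz]; ring, Real.cos_add_nat_mul_two_pi,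
      Real.cos_pi_sub]
  have h2 : Real.cos (2 * π * a ^ 2 - (4 * N + 2) * π * a - π / 8) = -Real.cos (π * (z ^ 2 / 2 + 3 / 8)) := by
    rw [show 2 * π * a ^ 2 - (4 * N + 2) * π * a - π / 8
        = (π * (z ^ 2 / 2 + 3 / 8) - π) - ((N * N + N : ℕ) : ℝ) * (2 * π) by rw [hz]; push_cast; ring,
      Real.cos_sub_nat_mul_two_pi, Real.cos_sub_pi]
  rw [h1, h2] at h
  rw [F, mul_div_assoc', eq_div_iff hcos]
  linear_combination -h

/-! ### `|T₀| ≤ (√2/4) e^{π/4}`: move the line to `N + ½` -/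

/-- The numerator `h(x) = e^{2πi(x−a)²}/(2i)` in the template of `SiegelMordellIntegral.lean`:
`h(x) = G(x) e^{πix² − 4πiax}`, `G(x) = (2i)⁻¹ e^{2πia²} e^{πix²}`. [folklore] -/
private lemma lead_num_eq (a : ℝ) (x : ℂ) :
    cexp (2 * π * I * (x - a) ^ 2) / (2 * I)
      = ((2 * I)⁻¹ * cexp (2 * π * I * (a : ℂ) ^ 2) * cexp (π * I * x ^ 2))
          * cexp (π * I * x ^ 2 + (-(4 * π * I * a)) * x) := by
  conv_rhs => rw [mul_assoc, mul_assoc, ← Complex.exp_add, ← Complex.exp_add]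
  rw [div_eq_inv_mul]
  congr 2; ring

/-- `‖(2i)⁻¹ e^{2πia²} e^{πix²}‖ ≤ ½ e^{πc²/2}` at `x = c + u(1+i)`. [folklore] -/
private lemma norm_lead_weight_le (a c u : ℝ) :
    ‖(2 * I)⁻¹ * cexp (2 * π * I * (a : ℂ) ^ 2) * cexp (π * I * (line c u) ^ 2)‖ ≤ 1 / 2 * Real.exp (π * c ^ 2 / 2) := by
  have h := norm_cexp_quadPhase 0 c u
  simp only [zero_mul, add_zero, zero_re, zero_im, sub_zero] at h
  have h2 : ‖cexp (2 * π * I * (a : ℂ) ^ 2)‖ = 1 := by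
    rw [show 2 * ↑π * I * (a : ℂ) ^ 2 = ((2 * π * a ^ 2 : ℝ) : ℂ) * I by push_cast; ring,
      Complex.norm_exp_ofReal_mul_I]
  rw [norm_mul, norm_mul, h2, h, mul_one]
  have h1 : ‖(2 * I : ℂ)⁻¹‖ = 1 / 2 := by norm_num [norm_inv, norm_mul, Complex.norm_I]
  rw [h1]
  refine mul_le_mul_of_nonneg_left (Real.exp_le_exp.2 ?_) (by norm_num)
  nlinarith [sq_nonneg (u + c / 2), Real.pi_pos]

/-- Integrability of `e^{2πi(x−a)²}/(2i sin πx)` along the line of slope one through any non-integer `c`. [folklore] -/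
private lemma integrable_lead_line (a : ℝ) {c : ℝ} (hc : ∀ n : ℤ, (n : ℝ) ≠ c) :
    Integrable fun u : ℝ ↦ cexp (2 * π * I * (line c u - a) ^ 2) / (2 * I * Complex.sin (π * line c u)) := by
  obtain ⟨d, hd0, hd⟩ := exists_pos_le_abs_sub_int hc
  have h := integrable_mul_cexp_quadPhase_div_sin
    (g := fun u : ℝ ↦ (2 * I)⁻¹ * cexp (2 * π * I * (a : ℂ) ^ 2) * cexp (π * I * (line c u) ^ 2)) (by fun_prop)
    (C := 1 / 2 * Real.exp (π * c ^ 2 / 2)) (N := 0)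
    (fun u ↦ by simpa using norm_lead_weight_le a c u) (-(4 * π * I * a)) hd0 hd
  refine h.congr (Eventually.of_forall fun u ↦ ?_)
  simp only
  rw [← lead_num_eq, div_div]

/-- The line may be moved from `a` to `N + ½` (no pole in between). [folklore] -/
private lemma integral_lead_line_eq (ha : 0 < a) (hai : ∀ n : ℤ, (n : ℝ) ≠ a) :
    ∫ u : ℝ, cexp (2 * π * I * (line a u - a) ^ 2) / (2 * I * Complex.sin (π * line a u))
      = ∫ u : ℝ, cexp (2 * π * I * (line (⌊a⌋₊ + 1 / 2) u - a) ^ 2)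
          / (2 * I * Complex.sin (π * line (⌊a⌋₊ + 1 / 2) u)) := by
  set c : ℝ := ⌊a⌋₊ + 1 / 2 with hc
  have hci : ∀ n : ℤ, (n : ℝ) ≠ c := by
    intro n h
    have h1 : (2 * n : ℤ) = 2 * (⌊a⌋₊ : ℤ) + 1 := by
      have : (2 * n : ℝ) = 2 * ⌊a⌋₊ + 1 := by rw [h, hc]; ring
      exact_mod_cast this
    omega
  have hfl : ⌊c⌋ = ⌊a⌋ := by
    rw [hc, ← Int.natCast_floor_eq_floor ha.le, Int.floor_eq_iff]
    simp only [Int.cast_natCast]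
    constructor <;> linarith
  -- generic residue theorem with an empty set of poles
  have key : ∀ {c₁ c₂ : ℝ}, c₁ < c₂ → (∀ n : ℤ, (n : ℝ) ≠ c₁) → (∀ n : ℤ, (n : ℝ) ≠ c₂) → ⌊c₁⌋ = ⌊c₂⌋ →
      ∫ u : ℝ, cexp (2 * π * I * (line c₂ u - a) ^ 2) / (2 * I * Complex.sin (π * line c₂ u))
        = ∫ u : ℝ, cexp (2 * π * I * (line c₁ u - a) ^ 2) / (2 * I * Complex.sin (π * line c₁ u)) := by
    intro c₁ c₂ h12 h1 h2 hfloor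
    set hnum : ℂ → ℂ := fun x ↦ cexp (2 * π * I * (x - a) ^ 2) / (2 * I) with hh
    have hker : ∀ x : ℂ, cexp (2 * π * I * (x - a) ^ 2) / (2 * I * Complex.sin (π * x))
        = hnum x / Complex.sin (π * x) := fun x ↦ by rw [hh, div_div]
    have hhd : Differentiable ℂ hnum := by rw [hh]; fun_prop
    have hint : ∀ c : ℝ, (∀ n : ℤ, (n : ℝ) ≠ c) →
        Integrable fun u : ℝ ↦ hnum (line c u) / Complex.sin (π * line c u) := fun c hcn ↦
      (integrable_lead_line a hcn).congr (Eventually.of_forall fun u ↦ hker _)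
    set M : ℝ := c₁ ^ 2 + c₂ ^ 2 with hM
    have hdecay := decay_mul_cexp_quadPhase_div_sin
      (G := fun z : ℂ ↦ (2 * I)⁻¹ * cexp (2 * π * I * (a : ℂ) ^ 2) * cexp (π * I * z ^ 2))
      (C := 1 / 2 * Real.exp (π * M / 2)) (N := 0) (c₁ := c₁) (c₂ := c₂) (fun c hcI T _ ↦ by
        simp only [pow_zero, mul_one]
        refine (norm_lead_weight_le a c T).trans (mul_le_mul_of_nonneg_left (Real.exp_le_exp.2 ?_) (by norm_num))
        have hc2 : c ^ 2 ≤ M := by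
          rw [hM]
          rcases le_or_gt 0 c with h0 | h0
          · nlinarith [hcI.2, sq_nonneg c₁]
          · nlinarith [hcI.1, sq_nonneg c₂]
        nlinarith [Real.pi_pos])
      (-(4 * π * I * a))
    have hmain := Literature.Analysis.Complex.integral_slant_div_sin_sub_eq_sum (h := hnum)
      h12 h1 h2 univ isOpen_univ (subset_univ _) hhd.differentiableOn (hint _ h1) (hint _ h2)
      (by simpa only [hh, lead_num_eq] using hdecay)
    rw [hfloor, Finset.Ioc_self, Finset.sum_empty, mul_zero, sub_eq_zero] at hmain
    simp only [hker]
    exact hmain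
  rcases lt_trichotomy a c with hlt | heq | hgt
  · exact (key hlt hai hci (by rw [hfl])).symm
  · rw [heq]
  · exact key hgt hci hai hfl

/-- On the line through `N + ½`: `‖e^{2πi(x−a)²}/(2i sin πx)‖ ≤ ½ e^{−4πu(u + d)}`, `d = N + ½ − a`
(`|sin π(N + ½ + u(1+i))|² = cos²(πu) + sinh²(πu) ≥ 1`). [folklore] -/
private lemma norm_lead_half_le (N : ℕ) (a u : ℝ) :
    ‖cexp (2 * π * I * (line (N + 1 / 2) u - a) ^ 2) / (2 * I * Complex.sin (π * line (N + 1 / 2) u))‖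
      ≤ 1 / 2 * Real.exp (-4 * π * u * (u + (N + 1 / 2 - a))) := by
  set d : ℝ := N + 1 / 2 - a with hd
  -- numerator
  have hnum : ‖cexp (2 * π * I * (line (N + 1 / 2) u - a) ^ 2)‖ = Real.exp (-4 * π * u * (u + d)) := by
    rw [Complex.norm_exp]
    congr 1
    simp only [line, hd]
    simp only [sq, Complex.mul_re, Complex.mul_im, Complex.add_re, Complex.add_im, Complex.sub_re,
      Complex.sub_im, Complex.ofReal_re, Complex.ofReal_im, Complex.I_re, Complex.I_im, Complex.re_ofNat,
      Complex.im_ofNat, Complex.one_re, Complex.one_im]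
    ring
  -- denominator
  have hden : 2 ≤ ‖2 * I * Complex.sin (π * line (N + 1 / 2) u)‖ := by
    have hsq : ‖Complex.sin (π * line ((N : ℝ) + 1 / 2) u)‖ ^ 2
        = Real.sin (π * ((N : ℝ) + 1 / 2 + u)) ^ 2 + Real.sinh (π * u) ^ 2 := by
      rw [show (π : ℂ) * line ((N : ℝ) + 1 / 2) u = ((π * ((N : ℝ) + 1 / 2 + u) : ℝ) : ℂ) + ((π * u : ℝ) : ℂ) * I by
        rw [line_eq]; push_cast; ring]
      exact sq_norm_sin_ofReal_add_mul_I _ _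
    have hsin : Real.sin (π * ((N : ℝ) + 1 / 2 + u)) ^ 2 = Real.cos (π * u) ^ 2 := by
      rw [show π * ((N : ℝ) + 1 / 2 + u) = (π * u + π / 2) + (N : ℕ) * π by ring,
        Real.sin_add_nat_mul_pi, Real.sin_add_pi_div_two, mul_pow]
      have : ((-1 : ℝ) ^ N) ^ 2 = 1 := by rw [← pow_mul, mul_comm, pow_mul]; norm_num
      rw [this, one_mul]
    have h1 : 1 ≤ ‖Complex.sin (π * line ((N : ℝ) + 1 / 2) u)‖ ^ 2 := by
      rw [hsq, hsin]
      have hs := Real.sin_sq_le_sq (x := π * u)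
      have hsh : (π * u) ^ 2 ≤ Real.sinh (π * u) ^ 2 := by
        have h0 : |π * u| ≤ Real.sinh |π * u| := Real.self_le_sinh_iff.2 (abs_nonneg _)
        rw [← Real.abs_sinh] at h0
        nlinarith [abs_nonneg (π * u), sq_abs (π * u), sq_abs (Real.sinh (π * u))]
      nlinarith [Real.sin_sq_add_cos_sq (π * u)]
    have h2 : 1 ≤ ‖Complex.sin (π * line ((N : ℝ) + 1 / 2) u)‖ := by
      nlinarith [norm_nonneg (Complex.sin (π * line ((N : ℝ) + 1 / 2) u))]
    rw [norm_mul, norm_mul, Complex.norm_I, Complex.norm_ofNat, mul_one]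
    linarith
  rw [norm_div, hnum, div_le_iff₀ (by linarith)]
  have hpos := Real.exp_pos (-4 * π * u * (u + d))
  nlinarith

/-- **Uniform bound for the leading term**: `|T₀(a)| ≤ (√2/4) e^{π/4}` for every non-integer `a > 0`
(the true supremum is `1/2`, attained as `a` tends to an integer). [cite: Gabcke1979, Kap. 1 eq. (1.14)] -/
theorem norm_rsT0_le (ha : 0 < a) (hai : ∀ n : ℤ, (n : ℝ) ≠ a) :
    ‖rsT0 a‖ ≤ Real.sqrt 2 / 4 * Real.exp (π / 4) := by
  have hT : ‖rsT0 a‖ = Real.sqrt 2 * ‖∫ u : ℝ, cexp (2 * π * I * (line (⌊a⌋₊ + 1 / 2) u - a) ^ 2)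
      / (2 * I * Complex.sin (π * line (⌊a⌋₊ + 1 / 2) u))‖ := by
    rw [rsT0_eq, integral_lead_line_eq ha hai, norm_mul, norm_neg, norm_mul, Complex.norm_exp]
    have : (-(↑π * I / 8)).re = 0 := by simp
    rw [this, Real.exp_zero, one_mul]
    have h2 : ‖(1 : ℂ) + I‖ = Real.sqrt 2 := by rw [Complex.norm_eq_sqrt_sq_add_sq]; norm_num
    rw [h2]
  rw [hT]
  set N : ℕ := ⌊a⌋₊ with hN
  set d : ℝ := N + 1 / 2 - a with hd
  have hd2 : d ^ 2 ≤ 1 / 4 := by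
    have h1 : (N : ℝ) ≤ a := Nat.floor_le ha.le
    have h2 : a < N + 1 := Nat.lt_floor_add_one a
    rw [hd]; nlinarith
  -- `∫ ½ e^{−4πu(u+d)} du = ½ · e^{πd²} · ½ ≤ e^{π/4}/4`
  have hgauss : ∫ u : ℝ, 1 / 2 * Real.exp (-4 * π * u * (u + d)) = 1 / 4 * Real.exp (π * d ^ 2) := by
    have h1 : (fun u : ℝ ↦ 1 / 2 * Real.exp (-4 * π * u * (u + d)))
        = fun u : ℝ ↦ 1 / 2 * Real.exp (π * d ^ 2) * Real.exp (-(4 * π) * (u + d / 2) ^ 2) := by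
      funext u
      rw [show 1 / 2 * Real.exp (π * d ^ 2) * Real.exp (-(4 * π) * (u + d / 2) ^ 2)
          = 1 / 2 * Real.exp (π * d ^ 2 + -(4 * π) * (u + d / 2) ^ 2) by rw [Real.exp_add]; ring]
      congr 2; ring
    rw [h1, MeasureTheory.integral_const_mul]
    have h2 := MeasureTheory.integral_add_right_eq_self (μ := volume)
      (fun u : ℝ ↦ Real.exp (-(4 * π) * u ^ 2)) (d / 2)
    rw [h2, integral_gaussian, show π / (4 * π) = (1 / 2) ^ 2 by field_simp; norm_num,
      Real.sqrt_sq (by norm_num)]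
    ring
  have hbound : ‖∫ u : ℝ, cexp (2 * π * I * (line (N + 1 / 2) u - a) ^ 2)
      / (2 * I * Complex.sin (π * line (N + 1 / 2) u))‖ ≤ 1 / 4 * Real.exp (π * d ^ 2) := by
    rw [← hgauss]
    refine MeasureTheory.norm_integral_le_of_norm_le ?_ (Eventually.of_forall fun u ↦ norm_lead_half_le N a u)
    have : (fun u : ℝ ↦ 1 / 2 * Real.exp (-4 * π * u * (u + d)))
        = fun u : ℝ ↦ (1 / 2 * Real.exp (π * d ^ 2)) * Real.exp (-(4 * π) * (u + d / 2) ^ 2) := by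
      funext u
      rw [show 1 / 2 * Real.exp (π * d ^ 2) * Real.exp (-(4 * π) * (u + d / 2) ^ 2)
          = 1 / 2 * Real.exp (π * d ^ 2 + -(4 * π) * (u + d / 2) ^ 2) by rw [Real.exp_add]; ring]
      congr 2; ring
    rw [this]
    exact ((integrable_exp_neg_mul_sq (by positivity : (0:ℝ) < 4 * π)).comp_add_right (d / 2)).const_mul _
  calc Real.sqrt 2 * ‖∫ u : ℝ, cexp (2 * π * I * (line (N + 1 / 2) u - a) ^ 2)
        / (2 * I * Complex.sin (π * line (N + 1 / 2) u))‖
      ≤ Real.sqrt 2 * (1 / 4 * Real.exp (π * d ^ 2)) := mul_le_mul_of_nonneg_left hbound (Real.sqrt_nonneg _)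
    _ ≤ Real.sqrt 2 * (1 / 4 * Real.exp (π / 4)) := by
        gcongr; nlinarith [Real.pi_pos]
    _ = Real.sqrt 2 / 4 * Real.exp (π / 4) := by ring

/-! ## The remainder `R₀` -/

/-- `|U* − 1| ≤ 2K(¼)/t` for `t ≥ 2` (the tree's explicit Stirling bound for `ϑ`; Gabcke bounds `U − 1` by his (4)–(5),
Satz 4.2.4). [cite: Gabcke1979, Kap. 1 eq. (1.11)] -/
theorem norm_uStar_sub_one_le (ht : 2 ≤ t) : ‖uStar t - 1‖ ≤ 2 * stirlingVertRate (1 / 4) / t := by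
  have h := abs_riemannSiegelTheta_sub_stirling_le ht
  rw [uStar, mul_comm]
  refine Real.norm_exp_I_mul_ofReal_sub_one_le.trans ?_
  rw [Real.norm_eq_abs, thetaMain]
  exact h

/-- `|k(a,u) − k₀(a,u)| ≤ e^{−4πu²} |g̃(a,u) − 1| / (2 sinh(π|u|))` (uniformly in `a`:
`|sin π(a + u + iu)|² = sin² + sinh² ≥ sinh²(πu)`). [cite: Gabcke1979, §3.1 Satz 3.1.3] -/
theorem norm_rsKer_sub_rsKer0_le (a : ℝ) {u : ℝ} (hu : u ≠ 0) :
    ‖rsKer a u - rsKer0 a u‖ ≤ Real.exp (-4 * π * u ^ 2) * ‖gTilde a u - 1‖ / (2 * Real.sinh (π * |u|)) := by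
  have hsinh : 0 < Real.sinh (π * |u|) := Real.sinh_pos_iff.2 (by positivity)
  have hden : 2 * Real.sinh (π * |u|) ≤ ‖2 * I * Complex.sin (π * line a u)‖ := by
    have hsq : ‖Complex.sin (π * line a u)‖ ^ 2 = Real.sin (π * (a + u)) ^ 2 + Real.sinh (π * u) ^ 2 := by
      rw [show (π : ℂ) * line a u = ((π * (a + u) : ℝ) : ℂ) + ((π * u : ℝ) : ℂ) * I by
        rw [line_eq]; push_cast; ring]
      exact sq_norm_sin_ofReal_add_mul_I _ _
    have h1 : Real.sinh (π * |u|) ≤ ‖Complex.sin (π * line a u)‖ := by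
      have h2 : Real.sinh (π * |u|) ^ 2 ≤ ‖Complex.sin (π * line a u)‖ ^ 2 := by
        rw [hsq, show π * |u| = |π * u| by rw [abs_mul, abs_of_pos Real.pi_pos], ← Real.abs_sinh, sq_abs]
        nlinarith [sq_nonneg (Real.sin (π * (a + u)))]
      have := Real.sqrt_le_sqrt h2
      rwa [Real.sqrt_sq hsinh.le, Real.sqrt_sq (norm_nonneg _)] at this
    rw [norm_mul, norm_mul, Complex.norm_I, Complex.norm_ofNat, mul_one]
    linarith
  have hdiff : rsKer a u - rsKer0 a u
      = (Real.exp (-4 * π * u ^ 2) : ℂ) * (gTilde a u - 1) / (2 * I * Complex.sin (π * line a u)) := by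
    rw [rsKer, rsKer0]; ring
  rw [hdiff, norm_div, norm_mul, Complex.norm_real, Real.norm_eq_abs, abs_of_pos (Real.exp_pos _)]
  exact div_le_div_of_nonneg_left (by positivity) (by positivity) hden

/-- `k₀(a, ·)` is integrable along the line through a non-integer `a` (convergence of the integral (1.13)).
[cite: Gabcke1979, Kap. 1 eq. (1.13)] -/
theorem integrable_rsKer0 (hai : ∀ n : ℤ, (n : ℝ) ≠ a) : Integrable fun u : ℝ ↦ rsKer0 a u := by
  refine (integrable_rsLeadKernel_line hai).congr (Eventually.of_forall fun u ↦ ?_)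
  simp only [rsKer0, cexp_sq_line_sub]

/-- `k(a, ·)` is integrable along the line through a non-integer `a > 0` (it is a constant multiple of Siegel's
integrand, `SiegelIntegral.integrable_rsKernel_line`; convergence of the integral `S` in (1.9)).
[cite: Gabcke1979, Kap. 1 eq. (1.9)] -/
theorem integrable_rsKer (ha : 0 < a) (hai : ∀ n : ℤ, (n : ℝ) ≠ a) : Integrable fun u : ℝ ↦ rsKer a u := by
  obtain ⟨d, hd0, hd⟩ := exists_pos_le_abs_sub_int hai
  set t : ℝ := 2 * π * a ^ 2 with ht
  have hK := integrable_rsKernel_line (1 / 2 + t * I) ha hd0 hd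
  set C : ℂ := (a : ℂ) ^ (-(1 / 2 + t * I : ℂ)) * cexp (π * I * (a : ℂ) ^ 2) with hC
  have hC0 : C ≠ 0 := by
    refine mul_ne_zero ?_ (Complex.exp_ne_zero _)
    rw [Ne, Complex.cpow_eq_zero_iff, not_and_or]
    exact Or.inl (Complex.ofReal_ne_zero.2 ha.ne')
  refine ((hK.const_mul C⁻¹)).congr (Eventually.of_forall fun u ↦ ?_)
  simp only
  rw [rsKernel_saddle ha ht u, ← mul_assoc, inv_mul_cancel₀ hC0, one_mul]

/-- `|T(a) − T₀(a)| ≤ √2 ∫ |k(a,u) − k₀(a,u)| du`. [cite: Gabcke1979, §3.1 Satz 3.1.1] -/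
theorem norm_rsT_sub_rsT0_le (ha : 0 < a) (hai : ∀ n : ℤ, (n : ℝ) ≠ a) :
    ‖rsT a - rsT0 a‖ ≤ Real.sqrt 2 * ∫ u : ℝ, ‖rsKer a u - rsKer0 a u‖ := by
  have hsub : rsT a - rsT0 a = -(Real.sqrt 2 : ℂ) * cexp (π * I / 8) * ∫ u : ℝ, (rsKer a u - rsKer0 a u) := by
    rw [integral_sub (integrable_rsKer ha hai) (integrable_rsKer0 hai), rsT, rsT0]; ring
  rw [hsub, norm_mul, norm_mul, norm_neg, Complex.norm_real, Real.norm_eq_abs,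
    abs_of_nonneg (Real.sqrt_nonneg 2), Complex.norm_exp]
  have : (↑π * I / 8 : ℂ).re = 0 := by simp
  rw [this, Real.exp_zero, mul_one]
  exact mul_le_mul_of_nonneg_left (norm_integral_le_integral_norm _) (Real.sqrt_nonneg 2)

/-- **The remainder in terms of `T − T₀` and `U* − 1`**: for `t > 0` with `a = √(t/2π) ∉ ℤ`, `N ≥ 1` and
`cos πz ≠ 0`, `R₀(t) = (2/√a) Re(U*(T − T₀) + (U* − 1) T₀)`. [cite: Gabcke1979, Satz 1.2.1] -/
theorem R0_eq (ht : 0 < t) (hN : 1 ≤ Gabcke.N t) (hai : ∀ n : ℤ, (n : ℝ) ≠ Gabcke.a t)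
    (hcos : Real.cos (π * Gabcke.z t) ≠ 0) :
    R0 t = 2 / Real.sqrt (Gabcke.a t)
      * (uStar t * (rsT (Gabcke.a t) - rsT0 (Gabcke.a t)) + (uStar t - 1) * rsT0 (Gabcke.a t)).re := by
  have hA : 0 < Gabcke.a t := Real.sqrt_pos.2 (by positivity)
  have h1 := hardyZ_eq_mainSum_add ht hN hai
  have h2 := two_mul_re_rsT0 hA hai hcos
  rw [R0, h1]
  have h3 : (-1 : ℝ) ^ (Gabcke.N t + 1) * F (Gabcke.z t) = 2 * (rsT0 (Gabcke.a t)).re := by rw [h2]; rfl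
  rw [h3]
  have h4 : uStar t * (rsT (Gabcke.a t) - rsT0 (Gabcke.a t)) + (uStar t - 1) * rsT0 (Gabcke.a t)
      = uStar t * rsT (Gabcke.a t) - rsT0 (Gabcke.a t) := by
    ring
  rw [h4, Complex.sub_re]
  have hs : Real.sqrt (Gabcke.a t) ≠ 0 := (Real.sqrt_pos.2 hA).ne'
  field_simp
  ring

/-- **The `K = 0` remainder bound in abstract form**: for `t ≥ 2` with `a = √(t/2π) ∉ ℤ`, `N ≥ 1`, `cos πz ≠ 0`,
`|R₀(t)| ≤ (2/√a) (√2 ∫ |k − k₀| du + (2K(¼)/t) (√2/4) e^{π/4})`; the integral is estimated in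
`RiemannSiegelRemainderK0.lean`. [cite: Gabcke1979, §3.2 Satz 3.2.2] -/
theorem abs_R0_le (ht : 2 ≤ t) (hN : 1 ≤ Gabcke.N t) (hai : ∀ n : ℤ, (n : ℝ) ≠ Gabcke.a t)
    (hcos : Real.cos (π * Gabcke.z t) ≠ 0) :
    |R0 t| ≤ 2 / Real.sqrt (Gabcke.a t) * (Real.sqrt 2 * (∫ u : ℝ, ‖rsKer (Gabcke.a t) u - rsKer0 (Gabcke.a t) u‖)
      + 2 * stirlingVertRate (1 / 4) / t * (Real.sqrt 2 / 4 * Real.exp (π / 4))) := by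
  have ht0 : 0 < t := by linarith
  have hA : 0 < Gabcke.a t := Real.sqrt_pos.2 (by positivity)
  rw [R0_eq ht0 hN hai hcos, abs_mul, abs_of_pos (by positivity : 0 < 2 / Real.sqrt (Gabcke.a t))]
  refine mul_le_mul_of_nonneg_left ?_ (by positivity)
  have h1 : ‖uStar t * (rsT (Gabcke.a t) - rsT0 (Gabcke.a t))‖
      ≤ Real.sqrt 2 * (∫ u : ℝ, ‖rsKer (Gabcke.a t) u - rsKer0 (Gabcke.a t) u‖) := by
    rw [norm_mul, uStar, Complex.norm_exp_ofReal_mul_I, one_mul]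
    exact norm_rsT_sub_rsT0_le hA hai
  have hK0 : 0 ≤ 2 * stirlingVertRate (1 / 4) / t := by
    have : 0 ≤ stirlingVertRate (1 / 4) := by rw [stirlingVertRate]; positivity
    positivity
  have h2 : ‖(uStar t - 1) * rsT0 (Gabcke.a t)‖
      ≤ 2 * stirlingVertRate (1 / 4) / t * (Real.sqrt 2 / 4 * Real.exp (π / 4)) := by
    rw [norm_mul]
    exact mul_le_mul (norm_uStar_sub_one_le ht) (norm_rsT0_le hA hai) (norm_nonneg _) hK0
  calc |(uStar t * (rsT (Gabcke.a t) - rsT0 (Gabcke.a t)) + (uStar t - 1) * rsT0 (Gabcke.a t)).re|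
      ≤ ‖uStar t * (rsT (Gabcke.a t) - rsT0 (Gabcke.a t)) + (uStar t - 1) * rsT0 (Gabcke.a t)‖ :=
        Complex.abs_re_le_norm _
    _ ≤ ‖uStar t * (rsT (Gabcke.a t) - rsT0 (Gabcke.a t))‖ + ‖(uStar t - 1) * rsT0 (Gabcke.a t)‖ :=
        norm_add_le _ _
    _ ≤ _ := add_le_add h1 h2

end Gabcke

end Literature.NumberTheory.LFunctions
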